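import Literature.NumberTheory.EllipticCurves.TateCurve.TateFormalThetaDefs
import Literature.NumberTheory.EllipticCurves.TateCurve.FormalEulerProduct
import Literature.NumberTheory.EllipticCurves.TateCurve.TateFormalIdentity
import Literature.NumberTheory.EllipticCurves.TateCurve.UniformizationThetaZeros
import HarnessLib

/-!
# The formal theta relation of the Tate curve: evaluation on the annulus configuration
# (Silverman, *Advanced Topics*, Prop. V.3.2 (b)(i), PDF pp. 399–400; proofs only)

Topic `Literature/NumberTheory/EllipticCurves/TateCurve`, namespace
`Literature.NumberTheory.EllipticCurves.TateCurve` (cell `bsd-eis`, seat `bsd-eis-k5-c4` g3; step T1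
of the discharge of `SteinWuthrich2013.exists_isSplitMultCanonical`). Theorems only.

For the formal theta relation `thetaRel ∈ ℤ[u₂^{±1}][u₁^{±1}]⟦q⟧` of `TateFormalThetaDefs.lean`
(`= (X̃₁A₂² − X̃₂A₁²)·Θ̃(u₁)²Θ̃(u₂)² + u₂A₁²A₂²·P̃(1)⁴·Θ̃(u₁u₂)Θ̃(u₁u₂⁻¹)`, Silverman Prop. V.3.2
(b)(i) cleared of denominators):

* `evCoeff₂_monoU₁` … — the monomials evaluate to `u₁^{±1}`, `u₂^{±1}`;
* `conv_thetaTilde`, `ev_thetaTilde` — `Θ̃(m, m')` converges for `‖q‖ < 1` and evaluates to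
  `(1 − m) P(m) P(m')` (`P = tateP q`, by `PowerSeriesEval.ev_eulerForm`);
* `conv_thetaRel`, **`ev_thetaRel`** — at `(u₁,u₂,q)` with `‖q‖ < 1` and `u₁, u₂` in the annulus
  `|q| < |u| < |q|⁻¹` (any complete normed field), `thetaRel` converges absolutely and
  `ev thetaRel = (1−u₁)²(1−u₂)² P(1)⁸ ((x₁−x₂)θ(u₁)²θ(u₂)² + u₂θ(u₁u₂)θ(u₁u₂⁻¹))` whenever
  `(1−uᵢ)²xᵢ = ev X̃(uᵢ)` (`θ = tateTheta q`).

## References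
* [SilvermanATAEC1994] J. H. Silverman, *Advanced Topics in the Arithmetic of Elliptic Curves*,
  GTM 151, Springer 1994, Prop. V.3.2 (PDF pp. 399–400); proof of Thm. V.3.1 (c) (PDF pp. 397–398).
-/

noncomputable section

open LaurentPolynomial Finset

namespace Literature.NumberTheory.EllipticCurves.TateCurve

open SteinWuthrich2013

section Eval

variable {𝕜 : Type*} [NormedField 𝕜] (u₁ u₂ : 𝕜ˣ) {q : 𝕜}

/-- `u₁ ↦ u₁`. [cite: SilvermanATAEC1994, Thm. V.3.1 (c) (proof, PDF p. 398)] -/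
theorem evCoeff₂_monoU₁ : evCoeff₂ u₁ u₂ monoU₁ = (u₁ : 𝕜) := by
  rw [monoU₁, evCoeff₂_T, zpow_one]

/-- `u₁⁻¹ ↦ u₁⁻¹`. [cite: SilvermanATAEC1994, Thm. V.3.1 (c) (proof, PDF p. 398)] -/
theorem evCoeff₂_monoU₁inv : evCoeff₂ u₁ u₂ monoU₁inv = (u₁ : 𝕜)⁻¹ := by
  rw [monoU₁inv, evCoeff₂_T, zpow_neg, zpow_one, Units.val_inv_eq_inv_val]

/-- `u₂ ↦ u₂`. [cite: SilvermanATAEC1994, Thm. V.3.1 (c) (proof, PDF p. 398)] -/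
theorem evCoeff₂_monoU₂ : evCoeff₂ u₁ u₂ monoU₂ = (u₂ : 𝕜) := by
  rw [monoU₂, evCoeff₂_C, evCoeff_T, zpow_one]

/-- `u₂⁻¹ ↦ u₂⁻¹`. [cite: SilvermanATAEC1994, Thm. V.3.1 (c) (proof, PDF p. 398)] -/
theorem evCoeff₂_monoU₂inv : evCoeff₂ u₁ u₂ monoU₂inv = (u₂ : 𝕜)⁻¹ := by
  rw [monoU₂inv, evCoeff₂_C, evCoeff_T, zpow_neg, zpow_one, Units.val_inv_eq_inv_val]

variable [CompleteSpace 𝕜]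

/-- `Θ̃(m, m')` converges absolutely for `‖q‖ < 1`. [cite: SilvermanATAEC1994, Prop. V.3.2 (a) (PDF p. 399)] -/
theorem conv_thetaTilde (hq : ‖q‖ < 1) (m m' : LaurentPoly₂) :
    PowerSeriesEval.Conv (evCoeff₂ u₁ u₂) q (thetaTilde m m') :=
  ((PowerSeriesEval.Conv.C _ _ _).mul _ _ (PowerSeriesEval.conv_eulerForm _ _ _ hq)).mul _ _
    (PowerSeriesEval.conv_eulerForm _ _ _ hq)

/-- `ev Θ̃(m, m') = (1 − m(u₁,u₂)) · P(m(u₁,u₂)) · P(m'(u₁,u₂))`.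
[cite: SilvermanATAEC1994, Prop. V.3.2 (a) (PDF p. 399)] -/
theorem ev_thetaTilde (hq : ‖q‖ < 1) (m m' : LaurentPoly₂) :
    PowerSeriesEval.ev (evCoeff₂ u₁ u₂) q (thetaTilde m m') =
      (1 - evCoeff₂ u₁ u₂ m) * tateP q (evCoeff₂ u₁ u₂ m) * tateP q (evCoeff₂ u₁ u₂ m') := by
  unfold thetaTilde
  rw [PowerSeriesEval.ev_mul _ _ ((PowerSeriesEval.Conv.C _ _ _).mul _ _
      (PowerSeriesEval.conv_eulerForm _ _ _ hq)) (PowerSeriesEval.conv_eulerForm _ _ _ hq),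
    PowerSeriesEval.ev_mul _ _ (PowerSeriesEval.Conv.C _ _ _) (PowerSeriesEval.conv_eulerForm _ _ _ hq),
    PowerSeriesEval.ev_C, PowerSeriesEval.ev_eulerForm _ _ _ hq,
    PowerSeriesEval.ev_eulerForm _ _ _ hq, map_sub, map_one]

/-- **`thetaRel` converges absolutely** at `(u₁,u₂,q)` for `‖q‖ < 1` and `u₁, u₂` in the annulus
`|q| < |u| < |q|⁻¹`. [cite: SilvermanATAEC1994, Prop. V.3.2 (b) (PDF pp. 399–400)] -/
theorem conv_thetaRel (hq : ‖q‖ < 1) (h₁ : ‖q‖ < ‖(u₁ : 𝕜)‖) (h₁' : ‖(u₁ : 𝕜)‖ < ‖q‖⁻¹)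
    (h₂ : ‖q‖ < ‖(u₂ : 𝕜)‖) (h₂' : ‖(u₂ : 𝕜)‖ < ‖q‖⁻¹) :
    PowerSeriesEval.Conv (evCoeff₂ u₁ u₂) q thetaRel := by
  have hX₁ : PowerSeriesEval.Conv (evCoeff₂ u₁ u₂) q (PowerSeries.map ι₁ xForm) :=
    (conv_map_ι₁_iff _ _ _ _).mpr (evSummable_xForm u₁ h₁ h₁')
  have hX₂ : PowerSeriesEval.Conv (evCoeff₂ u₁ u₂) q (PowerSeries.map ι₂ xForm) :=
    (conv_map_ι₂_iff _ _ _ _).mpr (evSummable_xForm u₂ h₂ h₂')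
  have hΘ := conv_thetaTilde u₁ u₂ hq
  have hP₀ : PowerSeriesEval.Conv (evCoeff₂ u₁ u₂) q (eulerForm 1) :=
    PowerSeriesEval.conv_eulerForm _ _ _ hq
  unfold thetaRel
  exact ((((hX₁.mul _ _ (PowerSeriesEval.Conv.C _ _ _)).sub _ _
      (hX₂.mul _ _ (PowerSeriesEval.Conv.C _ _ _))).mul _ _ ((hΘ _ _).pow _ _ 2)).mul _ _
      ((hΘ _ _).pow _ _ 2)).add _ _
    ((((PowerSeriesEval.Conv.C _ _ _).mul _ _ (hP₀.pow _ _ 4)).mul _ _ (hΘ _ _)).mul _ _ (hΘ _ _))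

/-- **`ev thetaRel = (1−u₁)²(1−u₂)² P(1)⁸ · [(x₁ − x₂) θ(u₁)² θ(u₂)² + u₂ θ(u₁u₂) θ(u₁u₂⁻¹)]`** on the
annulus configuration, in any complete normed field (`θ = tateTheta q`, `P(1) = tateP q 1`), given
`(1−uᵢ)²xᵢ = ev X̃(uᵢ)`. [cite: SilvermanATAEC1994, Prop. V.3.2 (b) (PDF pp. 399–400)] -/
theorem ev_thetaRel (hq : ‖q‖ < 1) (h₁ : ‖q‖ < ‖(u₁ : 𝕜)‖) (h₁' : ‖(u₁ : 𝕜)‖ < ‖q‖⁻¹)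
    (h₂ : ‖q‖ < ‖(u₂ : 𝕜)‖) (h₂' : ‖(u₂ : 𝕜)‖ < ‖q‖⁻¹) {x₁ x₂ : 𝕜}
    (hx₁ : (1 - (u₁ : 𝕜)) ^ 2 * x₁ = ev xForm u₁ q) (hx₂ : (1 - (u₂ : 𝕜)) ^ 2 * x₂ = ev xForm u₂ q) :
    PowerSeriesEval.ev (evCoeff₂ u₁ u₂) q thetaRel =
      (1 - (u₁ : 𝕜)) ^ 2 * (1 - (u₂ : 𝕜)) ^ 2 * tateP q (1 : 𝕜) ^ 8 *
        ((x₁ - x₂) * tateTheta q (u₁ : 𝕜) ^ 2 * tateTheta q (u₂ : 𝕜) ^ 2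
          + (u₂ : 𝕜) * tateTheta q ((u₁ : 𝕜) * u₂) * tateTheta q ((u₁ : 𝕜) * (u₂ : 𝕜)⁻¹)) := by
  have hX₁ : PowerSeriesEval.Conv (evCoeff₂ u₁ u₂) q (PowerSeries.map ι₁ xForm) :=
    (conv_map_ι₁_iff _ _ _ _).mpr (evSummable_xForm u₁ h₁ h₁')
  have hX₂ : PowerSeriesEval.Conv (evCoeff₂ u₁ u₂) q (PowerSeries.map ι₂ xForm) :=
    (conv_map_ι₂_iff _ _ _ _).mpr (evSummable_xForm u₂ h₂ h₂')
  have hΘ := conv_thetaTilde u₁ u₂ hq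
  have hP₀ : PowerSeriesEval.Conv (evCoeff₂ u₁ u₂) q (eulerForm 1) :=
    PowerSeriesEval.conv_eulerForm _ _ _ hq
  have hC := fun c : LaurentPoly₂ => PowerSeriesEval.Conv.C (evCoeff₂ u₁ u₂) q c
  have hD := (hX₁.mul _ _ (hC ((1 - monoU₂) ^ 2))).sub _ _ (hX₂.mul _ _ (hC ((1 - monoU₁) ^ 2)))
  have hL₁ := hD.mul _ _ ((hΘ monoU₁ monoU₁inv).pow _ _ 2)
  have hL := hL₁.mul _ _ ((hΘ monoU₂ monoU₂inv).pow _ _ 2)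
  have hR₁ := (hC (monoU₂ * (1 - monoU₁) ^ 2 * (1 - monoU₂) ^ 2)).mul _ _ (hP₀.pow _ _ 4)
  have hR₂ := hR₁.mul _ _ (hΘ (monoU₁ * monoU₂) (monoU₁inv * monoU₂inv))
  have hR := hR₂.mul _ _ (hΘ (monoU₁ * monoU₂inv) (monoU₁inv * monoU₂))
  unfold thetaRel
  rw [PowerSeriesEval.ev_add _ _ hL hR, PowerSeriesEval.ev_mul _ _ hL₁ ((hΘ _ _).pow _ _ 2),
    PowerSeriesEval.ev_mul _ _ hD ((hΘ _ _).pow _ _ 2),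
    PowerSeriesEval.ev_sub _ _ (hX₁.mul _ _ (hC _)) (hX₂.mul _ _ (hC _)),
    PowerSeriesEval.ev_mul _ _ hX₁ (hC _), PowerSeriesEval.ev_mul _ _ hX₂ (hC _),
    PowerSeriesEval.ev_pow _ _ (hΘ _ _), PowerSeriesEval.ev_pow _ _ (hΘ _ _),
    PowerSeriesEval.ev_mul _ _ hR₂ (hΘ _ _), PowerSeriesEval.ev_mul _ _ hR₁ (hΘ _ _),
    PowerSeriesEval.ev_mul _ _ (hC _) (hP₀.pow _ _ 4), PowerSeriesEval.ev_pow _ _ hP₀,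
    ev_map_ι₁, ev_map_ι₂, PowerSeriesEval.ev_C, PowerSeriesEval.ev_C, PowerSeriesEval.ev_C,
    ev_thetaTilde u₁ u₂ hq, ev_thetaTilde u₁ u₂ hq, ev_thetaTilde u₁ u₂ hq, ev_thetaTilde u₁ u₂ hq,
    PowerSeriesEval.ev_eulerForm _ _ _ hq, ← hx₁, ← hx₂]
  simp only [map_mul, map_pow, map_sub, map_one, evCoeff₂_monoU₁, evCoeff₂_monoU₁inv,
    evCoeff₂_monoU₂, evCoeff₂_monoU₂inv]
  have hP : tateP q (1 : 𝕜) ≠ 0 := tateP_one_ne_zero hq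
  unfold tateTheta
  rw [mul_inv, mul_inv, inv_inv]
  field_simp

end Eval

end Literature.NumberTheory.EllipticCurves.TateCurve

end
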